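import Mathlib.Analysis.SpecialFunctions.Complex.Circle
import Mathlib.Analysis.SpecialFunctions.Complex.Arg
import Mathlib.Analysis.SpecialFunctions.Trigonometric.Bounds
import Mathlib.Analysis.Complex.ExponentialBounds
import Mathlib.MeasureTheory.Group.Integral
import Mathlib.MeasureTheory.Integral.Bochner.ContinuousLinearMap
import Mathlib.MeasureTheory.Measure.Tilted
import HarnessLib

/-!
# Anti-concentration of exponentially tilted Haar measures on `U(1)` with a complex parameter
# (Chatterjee 2026, Lemma 4.1 and Corollary 4.2)

Topic `Literature/Probability/LatticeModels` (single-spin / single-link input of the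
Mermin–Wagner-type and confinement arguments for `U(1)` lattice systems with COMPLEX couplings;
sibling of `PlanarComplexXYPowerLaw.lean` (Chatterjee 2026 Lemma 4.3) and of the `U(1)`-centre
confinement files `Literature/MathematicalPhysics/QuantumFieldTheory/CentralCircleConfinementD3*.lean`
(Chatterjee 2026 Thm 3.1), which were proved by the complex-rotation route and left these two
printed statements untyped).

**Source.** S. Chatterjee, *A short proof of confinement in three-dimensional lattice gauge
theories with a central `U(1)`*, arXiv:2602.00436 (2026) [Chatterjee2026CentralU1], §4 (held text
`paper:arxiv-2602.00436`, p. 6):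

> **Lemma 4.1.** Take any `w ∈ ℂ` and let `μ` be the probability measure on `U(1)` that has
> density proportional to `exp(Re(w z))` with respect to the Haar measure on `U(1)`. Then
> `∫∫ |z₁ − z₂|² dμ(z₁) dμ(z₂) ≥ C min{1, |w|⁻¹}`, where `C` is a positive universal constant.
>
> **Corollary 4.2.** Let `ξ` be a `U(1)`-valued random variable following the probability density
> `f` defined in Lemma 4.1. Then `|E(ξ)| ≤ 1 − C min{1, |w|⁻¹}`, where `C` is a positive universal
> constant.

(The held text extraction drops the symbols inside `exp{Re(·)}`; whether the density is
`exp Re(w z)` or `exp Re(w̄ z)` is immaterial — replace `w` by `w̄`, which has the same modulus.)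

**What is proved here**, for ANY left-invariant probability measure `σ` on `U(1) = Circle`
(i.e. the normalised Haar measure; the tree's `haarProbability Circle` and Mathlib-side
constructions both qualify) — `[MeasurableSpace Circle] [BorelSpace Circle]` are instance ARGUMENTS,
as in the sibling plane-rotator files — and with EXPLICIT constants:

* vocabulary: the tilt `tiltWeight w z = exp(Re(w z))`, its partition function
  `tiltPartition σ w = ∫ tiltWeight w dσ > 0`, the tilted expectation functional
  `tiltExpect σ w f = (∫ f · tiltWeight w dσ) / tiltPartition σ w` (the printed `∫ f dμ`), the
  complex mean `tiltMean σ w = E_μ(z)`, and the printed rate `anticoncRate w = min{1, |w|⁻¹}`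
  (rendered piecewise, `= 1` for `|w| ≤ 1` and `= |w|⁻¹` otherwise, so that `w = 0` gives `1` as
  printed and not Lean's `0⁻¹ = 0`);
* `tiltExpect_indicator_arc_le` — the heart of the printed proof: for a rotation `u ∈ U(1)` and
  the open arc `A = {z : |z₀ − z| < r}` with `2r ≤ |u − 1|` (so that `A`, `uA` are disjoint),
  `μ(A) ≤ 1 / (1 + exp(−(1 − Re u)|w|))` — from Haar invariance `μ^{±}(A) = μ(A u^{±1})` and the
  pointwise bound `ρ(uz) + ρ(u⁻¹z) ≥ 2 exp(−(1 − Re u)|w|) ρ(z)` (the print takes the geometric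
  mean and Cauchy–Schwarz; the arithmetic mean gives the same constant with one line less);
* `tiltExpect_normSq_sub_ge` — **Lemma 4.1 in the pointwise form** obtained in the printed proof
  one line before «integrating over `z` completes the proof»: for EVERY `z₀ ∈ U(1)`,
  `∫ |z₀ − z|² dμ(z) ≥ (3/128) · min{1, |w|⁻¹}`;
* `tiltExpect_tiltExpect_normSq_sub_ge` — **Lemma 4.1 as printed** (iterated = double integral):
  `∫∫ |z₁ − z₂|² dμ(z₁) dμ(z₂) ≥ (3/128) · min{1, |w|⁻¹}`;
* `tiltExpect_re_conj_mul_le` — every one-dimensional projection of the mean is bounded away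
  from `1`: `E_μ Re(z̄₀ z) ≤ 1 − (3/256) min{1, |w|⁻¹}` (`|z₀ − z|² = 2 − 2 Re(z̄₀ z)` on `U(1)`);
* `norm_tiltMean_le` — **Corollary 4.2**: `|E_μ(z)| ≤ 1 − (3/256) · min{1, |w|⁻¹}`.

The constants: the printed proof gives `μ(A) ≤ 1/(1 + e^{-1/2})` for the arc of chordal radius
`ε/4`, `ε² = min{1,|w|⁻¹}`, whence `∫|z₀ − z|² dμ ≥ (ε/4)² · e^{-1/2}/(1 + e^{-1/2}) ≥ (3/128) ε²`
(`e^{-1/2} ≥ 3/5`), and `1 − |E z| = ½ E|z₀ − z|²` for `z₀ = E z/|E z|` gives `3/256` (the print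
squares and takes a square root instead, loosing another factor `2`).

## References

* S. Chatterjee, arXiv:2602.00436 (2026), §4, Lemma 4.1, Corollary 4.2 (p. 6 of the held text).
  [Chatterjee2026CentralU1]
* N. D. Mermin, H. Wagner, Phys. Rev. Lett. 17 (1966) 1133 (context: the use made of Cor. 4.2 in
  Lemma 4.3 there).
-/

noncomputable section

open MeasureTheory Complex ComplexConjugate

namespace Literature.Probability.LatticeModels

namespace TiltedCircle

variable [MeasurableSpace Circle] [BorelSpace Circle] (σ : Measure Circle)

/-! ### 1. Vocabulary -/

/-- The exponential tilt `ρ_w(z) = exp(Re(w z))` of the Haar measure of `U(1)` by the complex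
parameter `w` (Chatterjee 2026, Lemma 4.1: «density proportional to `exp Re(w z)` with respect to
the Haar measure on `U(1)`»). [cite: Chatterjee2026CentralU1, §4 Lemma 4.1] -/
def tiltWeight (w : ℂ) (z : Circle) : ℝ :=
  Real.exp ((w * z).re)

/-- The partition function `Z = ∫ ρ_w dσ₀` of the tilt (Chatterjee 2026, proof of Lemma 4.1).
[cite: Chatterjee2026CentralU1, §4 proof of Lemma 4.1] -/
def tiltPartition (w : ℂ) : ℝ :=
  ∫ z, tiltWeight w z ∂σ

/-- The tilted expectation `E_μ f = ∫ f dμ = Z⁻¹ ∫ f ρ_w dσ₀` of a real observable under the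
probability measure `μ` of Lemma 4.1 (density `f = Z⁻¹ ρ_w` with respect to `σ₀`).
[cite: Chatterjee2026CentralU1, §4 Lemma 4.1] -/
def tiltExpect (w : ℂ) (f : Circle → ℝ) : ℝ :=
  (∫ z, f z * tiltWeight w z ∂σ) / tiltPartition σ w

/-- The complex mean `E(ξ) = Z⁻¹ ∫ z ρ_w(z) dσ₀(z)` of a `U(1)`-valued random variable `ξ` with the
law of Lemma 4.1 (Corollary 4.2). [cite: Chatterjee2026CentralU1, §4 Corollary 4.2] -/
def tiltMean (w : ℂ) : ℂ :=
  (∫ z, (z : ℂ) * (tiltWeight w z : ℂ) ∂σ) / (tiltPartition σ w : ℂ)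

/-- The printed rate `min{1, |w|⁻¹}` with the convention `|0|⁻¹ = ∞`: `1` for `|w| ≤ 1`, `|w|⁻¹`
otherwise. [cite: Chatterjee2026CentralU1, §4 Lemma 4.1] -/
def anticoncRate (w : ℂ) : ℝ :=
  if ‖w‖ ≤ 1 then 1 else ‖w‖⁻¹

/-! ### 2. Elementary properties -/

omit [MeasurableSpace Circle] [BorelSpace Circle] in
/-- Unfolding lemma. [cite: Chatterjee2026CentralU1, §4 Lemma 4.1 (set-up: the density `Z⁻¹ρ`)] -/
theorem tiltWeight_apply (w : ℂ) (z : Circle) : tiltWeight w z = Real.exp ((w * z).re) := rfl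

omit [MeasurableSpace Circle] [BorelSpace Circle] in
/-- The tilt is positive. [cite: Chatterjee2026CentralU1, §4 Lemma 4.1 (set-up: the density `Z⁻¹ρ`)] -/
theorem tiltWeight_pos (w : ℂ) (z : Circle) : 0 < tiltWeight w z := Real.exp_pos _

omit [MeasurableSpace Circle] [BorelSpace Circle] in
/-- `|Re(w z)| ≤ |w|` on the unit circle. [folklore] -/
private theorem abs_re_mul_coe_le (w : ℂ) (z : Circle) : |(w * z).re| ≤ ‖w‖ :=
  (abs_re_le_norm _).trans (by rw [norm_mul, Circle.norm_coe, mul_one])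

omit [MeasurableSpace Circle] [BorelSpace Circle] in
/-- Lower bound `e^{-|w|} ≤ ρ_w`. [cite: Chatterjee2026CentralU1, §4 Lemma 4.1 (set-up: the density `Z⁻¹ρ`)] -/
theorem exp_neg_norm_le_tiltWeight (w : ℂ) (z : Circle) : Real.exp (-‖w‖) ≤ tiltWeight w z :=
  Real.exp_le_exp.2 (neg_le_of_abs_le (abs_re_mul_coe_le w z))

omit [MeasurableSpace Circle] [BorelSpace Circle] in
/-- Upper bound `ρ_w ≤ e^{|w|}`. [cite: Chatterjee2026CentralU1, §4 Lemma 4.1 (set-up: the density `Z⁻¹ρ`)] -/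
theorem tiltWeight_le_exp_norm (w : ℂ) (z : Circle) : tiltWeight w z ≤ Real.exp ‖w‖ :=
  Real.exp_le_exp.2 (le_of_abs_le (abs_re_mul_coe_le w z))

omit [MeasurableSpace Circle] [BorelSpace Circle] in
/-- The tilt is continuous. [cite: Chatterjee2026CentralU1, §4 Lemma 4.1 (set-up: the density `Z⁻¹ρ`)] -/
theorem continuous_tiltWeight (w : ℂ) : Continuous (tiltWeight w) :=
  Real.continuous_exp.comp (Complex.continuous_re.comp (continuous_const.mul continuous_subtype_val))

omit [MeasurableSpace Circle] [BorelSpace Circle] in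
/-- The printed rate lies in `(0, 1]`. [cite: Chatterjee2026CentralU1, §4 Lemma 4.1 (the rate `min{1,|w|⁻¹}`)] -/
theorem anticoncRate_pos (w : ℂ) : 0 < anticoncRate w := by
  unfold anticoncRate
  split_ifs with h
  · exact one_pos
  · exact inv_pos.2 (lt_of_lt_of_le one_pos (le_of_lt (not_le.1 h)))

omit [MeasurableSpace Circle] [BorelSpace Circle] in
/-- The printed rate is at most `1`. [cite: Chatterjee2026CentralU1, §4 Lemma 4.1 (the rate `min{1,|w|⁻¹}`)] -/
theorem anticoncRate_le_one (w : ℂ) : anticoncRate w ≤ 1 := by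
  unfold anticoncRate
  split_ifs with h
  · exact le_rfl
  · exact inv_le_one_of_one_le₀ (le_of_lt (not_le.1 h))

omit [MeasurableSpace Circle] [BorelSpace Circle] in
/-- `min{1,|w|⁻¹} · |w| ≤ 1` (the printed «the last inequality holds because `ε ≤ |w|^{-1/2}`»). [cite: Chatterjee2026CentralU1, §4 proof of Lemma 4.1] -/
theorem anticoncRate_mul_norm_le_one (w : ℂ) : anticoncRate w * ‖w‖ ≤ 1 := by
  unfold anticoncRate
  split_ifs with h
  · rwa [one_mul]
  · rw [inv_mul_cancel₀ (lt_of_lt_of_le one_pos (le_of_lt (not_le.1 h))).ne']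

/-- A continuous real function on the (compact) circle is integrable for a finite measure. [folklore] -/
private theorem integrable_of_continuous' [IsFiniteMeasure σ] {f : Circle → ℝ} (hf : Continuous f) :
    Integrable f σ := by
  obtain ⟨C, hC⟩ := isCompact_univ.exists_bound_of_continuousOn hf.continuousOn
  exact Integrable.of_bound hf.aestronglyMeasurable C (ae_of_all _ fun x => hC x (Set.mem_univ x))

/-- A continuous complex function on the circle is integrable for a finite measure. [folklore] -/
private theorem integrable_of_continuous_complex' [IsFiniteMeasure σ] {f : Circle → ℂ}
    (hf : Continuous f) : Integrable f σ := by
  obtain ⟨C, hC⟩ := isCompact_univ.exists_bound_of_continuousOn hf.continuousOn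
  exact Integrable.of_bound hf.aestronglyMeasurable C (ae_of_all _ fun x => hC x (Set.mem_univ x))

/-- The tilt is integrable. [cite: Chatterjee2026CentralU1, §4 Lemma 4.1 (set-up: the density `Z⁻¹ρ`)] -/
theorem integrable_tiltWeight [IsFiniteMeasure σ] (w : ℂ) : Integrable (tiltWeight w) σ :=
  integrable_of_continuous' σ (continuous_tiltWeight w)

/-- An indicator of a measurable set against the tilt is integrable (the printed `μ(A)`). [cite: Chatterjee2026CentralU1, §4 proof of Lemma 4.1] -/
theorem integrable_indicator_mul_tiltWeight [IsFiniteMeasure σ] (w : ℂ) {A : Set Circle}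
    (hA : MeasurableSet A) : Integrable (fun z => A.indicator 1 z * tiltWeight w z) σ := by
  have h : (fun z => A.indicator (1 : Circle → ℝ) z * tiltWeight w z) = A.indicator (tiltWeight w) := by
    funext z
    by_cases hz : z ∈ A <;> simp [hz]
  rw [h]
  exact (integrable_tiltWeight σ w).indicator hA

/-- The partition function is at least `e^{-|w|}`, in particular positive, for a probability
measure `σ`. [cite: Chatterjee2026CentralU1, §4 proof of Lemma 4.1] -/
theorem exp_neg_norm_le_tiltPartition [IsProbabilityMeasure σ] (w : ℂ) :
    Real.exp (-‖w‖) ≤ tiltPartition σ w := by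
  have h := integral_mono (integrable_const (Real.exp (-‖w‖))) (integrable_tiltWeight σ w)
    (fun z => exp_neg_norm_le_tiltWeight w z)
  simpa [tiltPartition] using h

/-- `0 < Z`. [cite: Chatterjee2026CentralU1, §4 proof of Lemma 4.1] -/
theorem tiltPartition_pos [IsProbabilityMeasure σ] (w : ℂ) : 0 < tiltPartition σ w :=
  lt_of_lt_of_le (Real.exp_pos _) (exp_neg_norm_le_tiltPartition σ w)

/-- The tilted expectation of a constant (`μ` is a probability measure). [cite: Chatterjee2026CentralU1, §4 Lemma 4.1 (set-up: the density `Z⁻¹ρ`)] -/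
theorem tiltExpect_const [IsProbabilityMeasure σ] (w : ℂ) (c : ℝ) : tiltExpect σ w (fun _ => c) = c := by
  unfold tiltExpect
  rw [integral_const_mul, ← tiltPartition, mul_div_assoc, div_self (tiltPartition_pos σ w).ne', mul_one]

/-- Monotonicity of the tilted expectation (for integrable tilted integrands; `μ` is a positive measure). [cite: Chatterjee2026CentralU1, §4 Lemma 4.1 (set-up: the density `Z⁻¹ρ`)] -/
theorem tiltExpect_mono [IsProbabilityMeasure σ] (w : ℂ) {f g : Circle → ℝ}
    (hf : Integrable (fun z => f z * tiltWeight w z) σ) (hg : Integrable (fun z => g z * tiltWeight w z) σ)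
    (hfg : ∀ z, f z ≤ g z) : tiltExpect σ w f ≤ tiltExpect σ w g := by
  unfold tiltExpect
  exact div_le_div_of_nonneg_right
    (integral_mono hf hg fun z => mul_le_mul_of_nonneg_right (hfg z) (tiltWeight_pos w z).le)
    (tiltPartition_pos σ w).le

/-- Linearity: `E(a·f + b) = a E f + b` (`μ` is a probability measure). [cite: Chatterjee2026CentralU1, §4 Lemma 4.1 (set-up: the density `Z⁻¹ρ`)] -/
theorem tiltExpect_const_mul_add_const [IsProbabilityMeasure σ] (w : ℂ) {f : Circle → ℝ}
    (hf : Integrable (fun z => f z * tiltWeight w z) σ) (a b : ℝ) :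
    tiltExpect σ w (fun z => a * f z + b) = a * tiltExpect σ w f + b := by
  have hZ := (tiltPartition_pos σ w).ne'
  unfold tiltExpect
  have h : (fun z => (a * f z + b) * tiltWeight w z) =
      fun z => a * (f z * tiltWeight w z) + b * tiltWeight w z := by
    funext z; ring
  rw [h, integral_add (hf.const_mul a) ((integrable_tiltWeight σ w).const_mul b), integral_const_mul,
    integral_const_mul, ← tiltPartition]
  field_simp

/-! ### 3. Haar invariance: rotating the tilt rotates the observable -/

/-- `∫ f(z) ρ_w(u z) dσ₀(z) = ∫ f(u⁻¹ z) ρ_w(z) dσ₀(z)` — the printed `μ^{+}(A) = μ(A e^{iε})`, by the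
invariance of the Haar measure. [cite: Chatterjee2026CentralU1, §4 proof of Lemma 4.1 (invariance of Haar measure)] -/
theorem integral_mul_tiltWeight_rotate [σ.IsMulLeftInvariant] (w : ℂ) (u : Circle) (f : Circle → ℝ) :
    ∫ z, f z * tiltWeight w (u * z) ∂σ = ∫ z, f (u⁻¹ * z) * tiltWeight w z ∂σ := by
  have h := integral_mul_left_eq_self (μ := σ) (fun z => f (u⁻¹ * z) * tiltWeight w z) u
  simp only [inv_mul_cancel_left] at h
  exact h

/-! ### 4. The two rotated tilts dominate the tilt -/

omit [MeasurableSpace Circle] [BorelSpace Circle] in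
/-- `Re(w u z) + Re(w ū z) = 2 Re(u) Re(w z)` for `u ∈ U(1)` (`ū = u⁻¹`). [folklore] -/
private theorem re_mul_rotate_add (w : ℂ) (u z : Circle) :
    (w * ↑(u * z)).re + (w * ↑(u⁻¹ * z)).re = 2 * (u : ℂ).re * (w * z).re := by
  rw [Circle.coe_mul, Circle.coe_mul, Circle.coe_inv_eq_conj]
  have h1 : w * ((u : ℂ) * z) = (w * z) * u := by ring
  have h2 : w * (conj (u : ℂ) * z) = (w * z) * conj (u : ℂ) := by ring
  rw [h1, h2]
  generalize w * (z : ℂ) = p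
  simp only [Complex.mul_re, Complex.conj_re, Complex.conj_im]
  ring

omit [MeasurableSpace Circle] [BorelSpace Circle] in
/-- `e^a + e^b ≥ 2 e^{(a+b)/2}`. [folklore] -/
private theorem two_mul_exp_half_le (a b : ℝ) : 2 * Real.exp ((a + b) / 2) ≤ Real.exp a + Real.exp b := by
  have ha : Real.exp a = Real.exp (a / 2) ^ 2 := by rw [sq, ← Real.exp_add]; ring_nf
  have hb : Real.exp b = Real.exp (b / 2) ^ 2 := by rw [sq, ← Real.exp_add]; ring_nf
  have hab : Real.exp ((a + b) / 2) = Real.exp (a / 2) * Real.exp (b / 2) := by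
    rw [← Real.exp_add]; ring_nf
  rw [ha, hb, hab]
  nlinarith [sq_nonneg (Real.exp (a / 2) - Real.exp (b / 2))]

omit [MeasurableSpace Circle] [BorelSpace Circle] in
/-- **`ρ_w(u z) + ρ_w(u⁻¹ z) ≥ 2 e^{−(1 − Re u)|w|} ρ_w(z)`** — the printed
`√(ρ⁺ρ⁻) ≥ ρ e^{−½|w| |e^{iε} + e^{−iε} − 2|}` with the arithmetic in place of the geometric mean.
[cite: Chatterjee2026CentralU1, §4 proof of Lemma 4.1 (display after (muplus))] -/
theorem two_mul_exp_mul_tiltWeight_le (w : ℂ) (u z : Circle) :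
    2 * Real.exp (-((1 - (u : ℂ).re) * ‖w‖)) * tiltWeight w z ≤
      tiltWeight w (u * z) + tiltWeight w (u⁻¹ * z) := by
  have hure : (u : ℂ).re ≤ 1 := (re_le_norm _).trans (Circle.norm_coe u).le
  have hre : (w * z).re ≤ ‖w‖ := le_of_abs_le (abs_re_mul_coe_le w z)
  have hsum := re_mul_rotate_add w u z
  have hmid : -((1 - (u : ℂ).re) * ‖w‖) + (w * z).re ≤
      ((w * ↑(u * z)).re + (w * ↑(u⁻¹ * z)).re) / 2 := by
    rw [hsum]
    nlinarith [mul_le_mul_of_nonneg_left hre (sub_nonneg.2 hure)]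
  calc 2 * Real.exp (-((1 - (u : ℂ).re) * ‖w‖)) * tiltWeight w z
      = 2 * Real.exp (-((1 - (u : ℂ).re) * ‖w‖) + (w * z).re) := by
        rw [tiltWeight, Real.exp_add]; ring
    _ ≤ 2 * Real.exp (((w * ↑(u * z)).re + (w * ↑(u⁻¹ * z)).re) / 2) := by
        gcongr
    _ ≤ tiltWeight w (u * z) + tiltWeight w (u⁻¹ * z) := two_mul_exp_half_le _ _

/-! ### 5. A short arc carries at most `1/(1 + e^{−(1−Re u)|w|})` of the mass -/

/-- The open arc of chordal radius `r` about `z₀`: `{z : |z₀ − z| < r}`.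
[cite: Chatterjee2026CentralU1, §4 proof of Lemma 4.1 (the set `A`)] -/
def arc (z₀ : Circle) (r : ℝ) : Set Circle :=
  {z | ‖(z₀ : ℂ) - z‖ < r}

omit [MeasurableSpace Circle] [BorelSpace Circle] in
/-- The arc is open. [folklore] -/
private theorem isOpen_arc (z₀ : Circle) (r : ℝ) : IsOpen (arc z₀ r) :=
  isOpen_lt (continuous_const.sub continuous_subtype_val).norm continuous_const

/-- The arc is measurable (the printed «for any measurable set `A`»). [cite: Chatterjee2026CentralU1, §4 proof of Lemma 4.1] -/
theorem measurableSet_arc (z₀ : Circle) (r : ℝ) : MeasurableSet (arc z₀ r) :=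
  (isOpen_arc z₀ r).measurableSet

omit [MeasurableSpace Circle] [BorelSpace Circle] in
/-- A rotation by `u` with `|u − 1| ≥ 2r` moves every point of the arc out of the arc (the printed
«`A ∩ A e^{iε}` is empty»). [cite: Chatterjee2026CentralU1, §4 proof of Lemma 4.1 (disjointness of `A` and `A e^{iε}`)] -/
theorem rotate_not_mem_arc {u : Circle} {r : ℝ} (hur : 2 * r ≤ ‖(u : ℂ) - 1‖) {z₀ z : Circle}
    (hz : z ∈ arc z₀ r) : u * z ∉ arc z₀ r := by
  intro huz
  simp only [arc, Set.mem_setOf_eq, Circle.coe_mul] at hz huz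
  have hdist : ‖(u : ℂ) * z - z‖ = ‖(u : ℂ) - 1‖ := by
    rw [← sub_one_mul, norm_mul, Circle.norm_coe, mul_one]
  have htri : ‖(u : ℂ) * z - z‖ ≤ ‖(z₀ : ℂ) - u * z‖ + ‖(z₀ : ℂ) - z‖ := by
    calc ‖(u : ℂ) * z - z‖ = ‖((z₀ : ℂ) - z) - ((z₀ : ℂ) - u * z)‖ := by congr 1; ring
      _ ≤ ‖(z₀ : ℂ) - z‖ + ‖(z₀ : ℂ) - u * z‖ := norm_sub_le _ _
      _ = ‖(z₀ : ℂ) - u * z‖ + ‖(z₀ : ℂ) - z‖ := add_comm _ _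
  linarith

omit [MeasurableSpace Circle] [BorelSpace Circle] in
/-- The same for the inverse rotation (`|u⁻¹ − 1| = |u − 1|`). [cite: Chatterjee2026CentralU1, §4 proof of Lemma 4.1 (the case `μ^{-}`)] -/
theorem rotate_inv_not_mem_arc {u : Circle} {r : ℝ} (hur : 2 * r ≤ ‖(u : ℂ) - 1‖) {z₀ z : Circle}
    (hz : z ∈ arc z₀ r) : u⁻¹ * z ∉ arc z₀ r := by
  refine rotate_not_mem_arc (u := u⁻¹) ?_ hz
  have h : ‖((u⁻¹ : Circle) : ℂ) - 1‖ = ‖(u : ℂ) - 1‖ := by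
    rw [Circle.coe_inv_eq_conj, ← Complex.norm_conj ((u : ℂ) - 1), map_sub, map_one]
  rwa [h]

/-- **The arc bound** (the printed `μ(A) ≤ 1/(1 + e^{−1/2})`, here with the rotation `u` and the
arc radius as parameters): if `2r ≤ |u − 1|` then for every centre `z₀`,
`μ(A) = E_μ 𝟙_A ≤ 1 / (1 + e^{−(1 − Re u)|w|})`. Proof as printed: `μ(Au) + μ(Au⁻¹) ≥ 2c μ(A)` by
Haar invariance and §4, while `A ∩ Au = A ∩ Au⁻¹ = ∅` gives `μ(A) + μ(Au^{±1}) ≤ 1`.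
[cite: Chatterjee2026CentralU1, §4 proof of Lemma 4.1] -/
theorem tiltExpect_indicator_arc_le [IsProbabilityMeasure σ] [σ.IsMulLeftInvariant] (w : ℂ)
    {u : Circle} {r : ℝ} (hur : 2 * r ≤ ‖(u : ℂ) - 1‖) (z₀ : Circle) :
    tiltExpect σ w ((arc z₀ r).indicator 1) ≤ 1 / (1 + Real.exp (-((1 - (u : ℂ).re) * ‖w‖))) := by
  set A := arc z₀ r with hA
  set h : Circle → ℝ := A.indicator 1 with hh
  set c : ℝ := Real.exp (-((1 - (u : ℂ).re) * ‖w‖)) with hc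
  set Z : ℝ := tiltPartition σ w with hZ
  set I : ℝ := ∫ z, h z * tiltWeight w z ∂σ with hI
  have hc0 : 0 < c := Real.exp_pos _
  have hZ0 : 0 < Z := tiltPartition_pos σ w
  have hAm : MeasurableSet A := measurableSet_arc z₀ r
  have h01 : ∀ z, h z = 0 ∨ h z = 1 := fun z => by
    by_cases hz : z ∈ A <;> simp [hh, hz]
  have hnn : ∀ z, 0 ≤ h z := fun z => by rcases h01 z with h0 | h0 <;> simp [h0]
  have hle1 : ∀ z, h z ≤ 1 := fun z => by rcases h01 z with h0 | h0 <;> simp [h0]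
  -- disjointness, pointwise
  have hP1 : ∀ z, h z + h (u⁻¹ * z) ≤ 1 := by
    intro z
    by_cases hz : z ∈ A
    · have : u⁻¹ * z ∉ A := rotate_inv_not_mem_arc hur hz
      simp [hh, hz, this]
    · have : h z = 0 := by simp [hh, hz]
      rw [this, zero_add]; exact hle1 _
  have hP2 : ∀ z, h z + h (u * z) ≤ 1 := by
    intro z
    by_cases hz : z ∈ A
    · have : u * z ∉ A := rotate_not_mem_arc hur hz
      simp [hh, hz, this]
    · have : h z = 0 := by simp [hh, hz]
      rw [this, zero_add]; exact hle1 _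
  -- integrability of the rotated indicators
  have hmeas_rot : ∀ v : Circle, MeasurableSet ((fun z => v * z) ⁻¹' A) := fun v =>
    hAm.preimage (measurable_const_mul v)
  have hrot_eq : ∀ v : Circle, (fun z => h (v * z)) = ((fun z => v * z) ⁻¹' A).indicator 1 := by
    intro v; funext z
    by_cases hz : v * z ∈ A <;> simp [hh, hz]
  have hint : Integrable (fun z => h z * tiltWeight w z) σ := integrable_indicator_mul_tiltWeight σ w hAm
  have hint_rot : ∀ v : Circle, Integrable (fun z => h (v * z) * tiltWeight w z) σ := by
    intro v
    have := integrable_indicator_mul_tiltWeight σ w (hmeas_rot v)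
    refine this.congr (ae_of_all _ fun z => ?_)
    have hz := congrFun (hrot_eq v) z
    show ((fun z => v * z) ⁻¹' A).indicator 1 z * tiltWeight w z = h (v * z) * tiltWeight w z
    rw [hz]
  have hintW := integrable_tiltWeight σ w
  -- (E): the rotated masses, by Haar invariance
  have hE1 : ∫ z, h (u⁻¹ * z) * tiltWeight w z ∂σ = ∫ z, h z * tiltWeight w (u * z) ∂σ :=
    (integral_mul_tiltWeight_rotate σ w u h).symm
  have hE2 : ∫ z, h (u * z) * tiltWeight w z ∂σ = ∫ z, h z * tiltWeight w (u⁻¹ * z) ∂σ := by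
    have := (integral_mul_tiltWeight_rotate σ w u⁻¹ h).symm
    simpa only [inv_inv] using this
  have hint_w1 : Integrable (fun z => h z * tiltWeight w (u * z)) σ := by
    have h1 : Integrable (fun z => h (u⁻¹ * (u * z)) * tiltWeight w (u * z)) σ :=
      (hint_rot u⁻¹).comp_mul_left u
    simpa only [inv_mul_cancel_left] using h1
  have hint_w2 : Integrable (fun z => h z * tiltWeight w (u⁻¹ * z)) σ := by
    have h1 : Integrable (fun z => h (u * (u⁻¹ * z)) * tiltWeight w (u⁻¹ * z)) σ :=
      (hint_rot u).comp_mul_left u⁻¹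
    simpa only [mul_inv_cancel_left] using h1
  -- lower bound: the two rotated masses dominate `2c I`
  have hlow : 2 * c * I ≤ ∫ z, h (u⁻¹ * z) * tiltWeight w z ∂σ + ∫ z, h (u * z) * tiltWeight w z ∂σ := by
    rw [hE1, hE2, ← integral_add hint_w1 hint_w2, hI, ← integral_const_mul]
    refine integral_mono (hint.const_mul _) (hint_w1.add hint_w2) fun z => ?_
    have := two_mul_exp_mul_tiltWeight_le w u z
    have hz := hnn z
    calc 2 * c * (h z * tiltWeight w z) = h z * (2 * c * tiltWeight w z) := by ring
      _ ≤ h z * (tiltWeight w (u * z) + tiltWeight w (u⁻¹ * z)) :=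
          mul_le_mul_of_nonneg_left this hz
      _ = h z * tiltWeight w (u * z) + h z * tiltWeight w (u⁻¹ * z) := by ring
  -- upper bound: disjointness
  have hint12 : Integrable (fun z => h (u⁻¹ * z) * tiltWeight w z + h (u * z) * tiltWeight w z) σ :=
    (hint_rot u⁻¹).add (hint_rot u)
  have hint3 : Integrable (fun z => 2 * (h z * tiltWeight w z) +
      (h (u⁻¹ * z) * tiltWeight w z + h (u * z) * tiltWeight w z)) σ := (hint.const_mul 2).add hint12
  have hup : 2 * I + (∫ z, h (u⁻¹ * z) * tiltWeight w z ∂σ + ∫ z, h (u * z) * tiltWeight w z ∂σ) ≤ 2 * Z := by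
    have hsum : ∫ z, (2 * (h z * tiltWeight w z) +
        (h (u⁻¹ * z) * tiltWeight w z + h (u * z) * tiltWeight w z)) ∂σ =
        2 * I + (∫ z, h (u⁻¹ * z) * tiltWeight w z ∂σ + ∫ z, h (u * z) * tiltWeight w z ∂σ) := by
      rw [integral_add (hint.const_mul 2) hint12, integral_const_mul, integral_add (hint_rot u⁻¹) (hint_rot u)]
    have h2Z : ∫ z, 2 * tiltWeight w z ∂σ = 2 * Z := by rw [integral_const_mul, hZ, tiltPartition]
    rw [← hsum, ← h2Z]
    refine integral_mono hint3 (hintW.const_mul 2) fun z => ?_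
    have h1 := hP1 z
    have h2 := hP2 z
    have hw := (tiltWeight_pos w z).le
    calc 2 * (h z * tiltWeight w z) + (h (u⁻¹ * z) * tiltWeight w z + h (u * z) * tiltWeight w z)
        = ((h z + h (u⁻¹ * z)) + (h z + h (u * z))) * tiltWeight w z := by ring
      _ ≤ (1 + 1) * tiltWeight w z := mul_le_mul_of_nonneg_right (add_le_add h1 h2) hw
      _ = 2 * tiltWeight w z := by norm_num
  -- conclude
  have hIZ : I * (1 + c) ≤ Z := by nlinarith
  change I / Z ≤ 1 / (1 + c)
  rw [div_le_div_iff₀ hZ0 (by positivity), one_mul]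
  exact hIZ

/-! ### 6. The rotation `e^{iε}`, `ε² = min{1,|w|⁻¹}` -/

omit [MeasurableSpace Circle] [BorelSpace Circle] in
/-- **The printed choice `ε = min{1, |w|^{-1/2}}`**: there is a rotation `u = e^{iε} ∈ U(1)` with
`(1 − Re u)|w| ≤ ½` (so `e^{−(1−Re u)|w|} ≥ e^{−1/2}`) and `|u − 1|² ≥ ¼ min{1, |w|⁻¹}` (the printed
`|z − z e^{iε}| ≥ ε/2`). [cite: Chatterjee2026CentralU1, §4 proof of Lemma 4.1 (choice of `ε`, (mainep))] -/
theorem exists_rotation (w : ℂ) :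
    ∃ u : Circle, (1 - (u : ℂ).re) * ‖w‖ ≤ 1 / 2 ∧ anticoncRate w / 4 ≤ ‖(u : ℂ) - 1‖ ^ 2 := by
  set ε : ℝ := Real.sqrt (anticoncRate w) with hε
  have hr0 : 0 < anticoncRate w := anticoncRate_pos w
  have hr1 : anticoncRate w ≤ 1 := anticoncRate_le_one w
  have hε0 : 0 < ε := Real.sqrt_pos.2 hr0
  have hε1 : ε ≤ 1 := by rw [hε, ← Real.sqrt_one]; exact Real.sqrt_le_sqrt hr1
  have hε2 : ε ^ 2 = anticoncRate w := Real.sq_sqrt hr0.le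
  refine ⟨Circle.exp ε, ?_, ?_⟩
  · -- `1 - cos ε ≤ ε²/2` and `ε² |w| ≤ 1`
    rw [Circle.coe_exp, exp_ofReal_mul_I_re]
    have hcos : 1 - Real.cos ε ≤ ε ^ 2 / 2 := by
      have := Real.one_sub_sq_div_two_le_cos (x := ε); linarith
    have hprod := anticoncRate_mul_norm_le_one w
    calc (1 - Real.cos ε) * ‖w‖ ≤ ε ^ 2 / 2 * ‖w‖ := mul_le_mul_of_nonneg_right hcos (norm_nonneg _)
      _ = anticoncRate w * ‖w‖ / 2 := by rw [hε2]; ring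
      _ ≤ 1 / 2 := by linarith
  · -- `|e^{iε} - 1| ≥ sin ε ≥ ε - ε³/6 ≥ ε/2`
    have him : (Complex.exp (ε * I) - 1).im = Real.sin ε := by
      rw [Complex.sub_im, exp_ofReal_mul_I_im, Complex.one_im, sub_zero]
    have hsin : ε / 2 ≤ Real.sin ε := by
      have h1 := Real.sin_gt_sub_cube hε0
      have h3 : ε ^ 3 ≤ ε := by
        calc ε ^ 3 = ε * (ε * ε) := by ring
          _ ≤ ε * (1 * 1) := by gcongr
          _ = ε := by ring
      linarith
    have hnorm : ε / 2 ≤ ‖(Circle.exp ε : ℂ) - 1‖ := by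
      rw [Circle.coe_exp]
      calc ε / 2 ≤ Real.sin ε := hsin
        _ ≤ |(Complex.exp (ε * I) - 1).im| := by rw [him]; exact le_abs_self _
        _ ≤ ‖Complex.exp (ε * I) - 1‖ := abs_im_le_norm _
    calc anticoncRate w / 4 = (ε / 2) ^ 2 := by rw [← hε2]; ring
      _ ≤ ‖(Circle.exp ε : ℂ) - 1‖ ^ 2 := by gcongr

omit [MeasurableSpace Circle] [BorelSpace Circle] in
/-- `e^{-1/2} ≥ 3/5` (numerics: `e ≤ 25/9`). [folklore] -/
private theorem three_fifths_le_exp_neg_half : (3 : ℝ) / 5 ≤ Real.exp (-(1 / 2 : ℝ)) := by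
  have he : Real.exp 1 < 2.7182818286 := Real.exp_one_lt_d9
  have h1 : Real.exp (1 / 2 : ℝ) ≤ 5 / 3 := by
    have hsq : Real.exp (1 / 2 : ℝ) ^ 2 = Real.exp 1 := by rw [sq, ← Real.exp_add]; norm_num
    nlinarith [Real.exp_pos (1 / 2 : ℝ)]
  rw [Real.exp_neg]
  rw [le_inv_comm₀ (by norm_num) (Real.exp_pos _)]
  linarith

/-! ### 7. Lemma 4.1 and Corollary 4.2 -/

/-- **Chatterjee 2026, Lemma 4.1 (pointwise form).** For every left-invariant probability measure
`σ₀` on `U(1)` (the Haar measure), every `w ∈ ℂ` and EVERY `z₀ ∈ U(1)`, the tilted law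
`dμ = Z⁻¹ exp(Re(w z)) dσ₀` satisfies `∫ |z₀ − z|² dμ(z) ≥ (3/128) · min{1, |w|⁻¹}` — the display
before «Integrating over `z` completes the proof». [cite: Chatterjee2026CentralU1, §4 Lemma 4.1 (proof, last display)] -/
theorem tiltExpect_normSq_sub_ge [IsProbabilityMeasure σ] [σ.IsMulLeftInvariant] (w : ℂ) (z₀ : Circle) :
    3 / 128 * anticoncRate w ≤ tiltExpect σ w (fun z => ‖(z₀ : ℂ) - z‖ ^ 2) := by
  obtain ⟨u, hu1, hu2⟩ := exists_rotation w
  set r : ℝ := ‖(u : ℂ) - 1‖ / 2 with hr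
  have hur : 2 * r ≤ ‖(u : ℂ) - 1‖ := by rw [hr]; linarith
  have hr2 : anticoncRate w / 16 ≤ r ^ 2 := by
    rw [hr, div_pow]; linarith
  set A := arc z₀ r with hA
  -- the arc bound with `c ≥ 3/5`: `μ(A) ≤ 5/8`
  have harc := tiltExpect_indicator_arc_le σ w hur z₀
  have hc : (3 : ℝ) / 5 ≤ Real.exp (-((1 - (u : ℂ).re) * ‖w‖)) :=
    three_fifths_le_exp_neg_half.trans (Real.exp_le_exp.2 (by linarith))
  have hμA : tiltExpect σ w (A.indicator 1) ≤ 5 / 8 := by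
    refine harc.trans ?_
    rw [div_le_div_iff₀ (by positivity) (by norm_num)]
    linarith
  -- pointwise: `|z₀ - z|² ≥ r² (1 - 𝟙_A z)`
  have hpt : ∀ z, r ^ 2 * (-(A.indicator (1 : Circle → ℝ) z)) + r ^ 2 ≤ ‖(z₀ : ℂ) - z‖ ^ 2 := by
    intro z
    by_cases hz : z ∈ A
    · have hz1 : A.indicator (1 : Circle → ℝ) z = 1 := Set.indicator_of_mem hz _
      rw [hz1, mul_neg_one, neg_add_cancel]
      positivity
    · have hge : r ≤ ‖(z₀ : ℂ) - z‖ := not_lt.1 (by simpa [hA, arc] using hz)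
      have hr0 : 0 ≤ r := by rw [hr]; positivity
      have hz0 : A.indicator (1 : Circle → ℝ) z = 0 := Set.indicator_of_notMem hz _
      rw [hz0, neg_zero, mul_zero, zero_add]
      exact pow_le_pow_left₀ hr0 hge 2
  have hintA : Integrable (fun z => A.indicator (1 : Circle → ℝ) z * tiltWeight w z) σ :=
    integrable_indicator_mul_tiltWeight σ w (measurableSet_arc z₀ r)
  have hintA' : Integrable (fun z => -(A.indicator (1 : Circle → ℝ) z) * tiltWeight w z) σ := by
    simpa [neg_mul] using hintA.neg
  have hintL : Integrable (fun z => (r ^ 2 * (-(A.indicator (1 : Circle → ℝ) z)) + r ^ 2) * tiltWeight w z) σ := by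
    have : (fun z => (r ^ 2 * (-(A.indicator (1 : Circle → ℝ) z)) + r ^ 2) * tiltWeight w z) =
        fun z => r ^ 2 * (-(A.indicator (1 : Circle → ℝ) z) * tiltWeight w z) + r ^ 2 * tiltWeight w z := by
      funext z; ring
    rw [this]
    exact (hintA'.const_mul _).add ((integrable_tiltWeight σ w).const_mul _)
  have hintR : Integrable (fun z : Circle => ‖(z₀ : ℂ) - z‖ ^ 2 * tiltWeight w z) σ :=
    integrable_of_continuous' σ (((continuous_const.sub continuous_subtype_val).norm.pow 2).mul
      (continuous_tiltWeight w))
  have hmono := tiltExpect_mono σ w hintL hintR hpt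
  have key : tiltExpect σ w (fun z => r ^ 2 * (-(A.indicator (1 : Circle → ℝ) z)) + r ^ 2) =
      r ^ 2 * tiltExpect σ w (fun z => -(A.indicator (1 : Circle → ℝ) z)) + r ^ 2 :=
    tiltExpect_const_mul_add_const σ w hintA' _ _
  rw [key] at hmono
  have hneg : tiltExpect σ w (fun z => -(A.indicator (1 : Circle → ℝ) z)) = -tiltExpect σ w (A.indicator 1) := by
    unfold tiltExpect
    rw [← neg_div, ← integral_neg]
    congr 1
    refine integral_congr_ae (ae_of_all _ fun z => ?_)
    simp only [neg_mul]
  rw [hneg] at hmono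
  have hr2' : 0 ≤ r ^ 2 := sq_nonneg _
  nlinarith

/-- **Chatterjee 2026, Lemma 4.1 (as printed).** `∫∫ |z₁ − z₂|² dμ(z₁) dμ(z₂) ≥ C min{1, |w|⁻¹}`
with `C = 3/128`, the double integral written as the iterated tilted expectation.
[cite: Chatterjee2026CentralU1, §4 Lemma 4.1] -/
theorem tiltExpect_tiltExpect_normSq_sub_ge [IsProbabilityMeasure σ] [σ.IsMulLeftInvariant] (w : ℂ) :
    3 / 128 * anticoncRate w ≤
      tiltExpect σ w (fun z₁ => tiltExpect σ w (fun z₂ => ‖(z₁ : ℂ) - z₂‖ ^ 2)) := by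
  have h := fun z₁ : Circle => tiltExpect_normSq_sub_ge σ w z₁
  -- the inner expectation is bounded below by the constant; integrate
  have hbound : ∀ z₁ : Circle, tiltExpect σ w (fun z₂ => ‖(z₁ : ℂ) - z₂‖ ^ 2) ≤ 4 := by
    intro z₁
    have hint4 : Integrable (fun z : Circle => (4 : ℝ) * tiltWeight w z) σ := (integrable_tiltWeight σ w).const_mul 4
    have hintR : Integrable (fun z : Circle => ‖(z₁ : ℂ) - z‖ ^ 2 * tiltWeight w z) σ :=
      integrable_of_continuous' σ (((continuous_const.sub continuous_subtype_val).norm.pow 2).mul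
        (continuous_tiltWeight w))
    have := tiltExpect_mono σ w hintR hint4 fun z => by
      have h2 : ‖(z₁ : ℂ) - z‖ ≤ 2 := by
        calc ‖(z₁ : ℂ) - z‖ ≤ ‖(z₁ : ℂ)‖ + ‖(z : ℂ)‖ := norm_sub_le _ _
          _ = 2 := by rw [Circle.norm_coe, Circle.norm_coe]; norm_num
      nlinarith [norm_nonneg ((z₁ : ℂ) - z)]
    rwa [tiltExpect_const] at this
  -- measurability of the inner expectation: it is continuous in `z₁`; we only need integrability
  -- of a bounded function, obtained from continuity of the parametric integral.
  have hcont : Continuous fun z₁ : Circle => tiltExpect σ w (fun z₂ => ‖(z₁ : ℂ) - z₂‖ ^ 2) := by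
    unfold tiltExpect
    refine Continuous.div_const ?_ _
    have hk : Continuous (Function.uncurry fun (z₁ z₂ : Circle) => ‖(z₁ : ℂ) - z₂‖ ^ 2 * tiltWeight w z₂) := by
      refine Continuous.mul ?_ ((continuous_tiltWeight w).comp continuous_snd)
      exact ((continuous_subtype_val.comp continuous_fst).sub
        (continuous_subtype_val.comp continuous_snd)).norm.pow 2
    have h1 := continuous_parametric_integral_of_continuous (μ := σ) hk isCompact_univ
    simpa only [Measure.restrict_univ, Function.uncurry] using h1
  have hintO : Integrable (fun z₁ : Circle => tiltExpect σ w (fun z₂ => ‖(z₁ : ℂ) - z₂‖ ^ 2) * tiltWeight w z₁) σ :=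
    integrable_of_continuous' σ (hcont.mul (continuous_tiltWeight w))
  have hintC : Integrable (fun z₁ : Circle => (3 / 128 * anticoncRate w) * tiltWeight w z₁) σ :=
    (integrable_tiltWeight σ w).const_mul _
  have := tiltExpect_mono σ w hintC hintO h
  rwa [tiltExpect_const] at this

omit [MeasurableSpace Circle] [BorelSpace Circle] in
/-- On the unit circle `Re(z̄₀ z) = 1 − ½ |z₀ − z|²` (the printed `|ξ₁ − ξ₂|² = 2 − 2 Re(ξ₁ ξ̄₂)`). [cite: Chatterjee2026CentralU1, §4 proof of Corollary 4.2] -/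
theorem re_conj_mul_eq (z₀ z : Circle) :
    (conj (z₀ : ℂ) * z).re = 1 - ‖(z₀ : ℂ) - z‖ ^ 2 / 2 := by
  have h0 : (z₀ : ℂ).re * (z₀ : ℂ).re + (z₀ : ℂ).im * (z₀ : ℂ).im = 1 := by
    have h := Circle.normSq_coe z₀
    rwa [Complex.normSq_apply] at h
  have h1 : (z : ℂ).re * (z : ℂ).re + (z : ℂ).im * (z : ℂ).im = 1 := by
    have h := Circle.normSq_coe z
    rwa [Complex.normSq_apply] at h
  rw [← Complex.normSq_eq_norm_sq, Complex.normSq_apply]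
  simp only [Complex.mul_re, Complex.conj_re, Complex.conj_im, Complex.sub_re, Complex.sub_im]
  linear_combination (1 / 2 : ℝ) * h0 + (1 / 2 : ℝ) * h1

/-- **Every projection of the mean is bounded away from `1`**: for every `z₀ ∈ U(1)`,
`E_μ Re(z̄₀ z) ≤ 1 − (3/256) min{1, |w|⁻¹}`. [cite: Chatterjee2026CentralU1, §4 Corollary 4.2 (proof)] -/
theorem tiltExpect_re_conj_mul_le [IsProbabilityMeasure σ] [σ.IsMulLeftInvariant] (w : ℂ) (z₀ : Circle) :
    tiltExpect σ w (fun z => (conj (z₀ : ℂ) * z).re) ≤ 1 - 3 / 256 * anticoncRate w := by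
  have h := tiltExpect_normSq_sub_ge σ w z₀
  have hintR : Integrable (fun z : Circle => ‖(z₀ : ℂ) - z‖ ^ 2 * tiltWeight w z) σ :=
    integrable_of_continuous' σ (((continuous_const.sub continuous_subtype_val).norm.pow 2).mul
      (continuous_tiltWeight w))
  have heq : (fun z : Circle => (conj (z₀ : ℂ) * z).re) =
      fun z : Circle => (-(1 / 2 : ℝ)) * ‖(z₀ : ℂ) - z‖ ^ 2 + 1 := by
    funext z; rw [re_conj_mul_eq]; ring
  have key : tiltExpect σ w (fun z : Circle => (conj (z₀ : ℂ) * z).re) =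
      (-(1 / 2 : ℝ)) * tiltExpect σ w (fun z : Circle => ‖(z₀ : ℂ) - z‖ ^ 2) + 1 := by
    rw [heq]; exact tiltExpect_const_mul_add_const σ w hintR _ _
  rw [key]
  linarith

/-- **Chatterjee 2026, Corollary 4.2.** For every left-invariant probability measure `σ₀` on `U(1)`
and every `w ∈ ℂ`, a `U(1)`-valued random variable `ξ` with density `Z⁻¹ exp(Re(w ξ))` with respect
to `σ₀` satisfies `|E(ξ)| ≤ 1 − C min{1, |w|⁻¹}` with `C = 3/256`.
[cite: Chatterjee2026CentralU1, §4 Corollary 4.2] -/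
theorem norm_tiltMean_le [IsProbabilityMeasure σ] [σ.IsMulLeftInvariant] (w : ℂ) :
    ‖tiltMean σ w‖ ≤ 1 - 3 / 256 * anticoncRate w := by
  set m : ℂ := tiltMean σ w with hm
  by_cases hm0 : m = 0
  · rw [hm0, norm_zero]
    have := anticoncRate_le_one w
    linarith
  -- the direction of the mean
  set z₀ : Circle := Circle.exp m.arg with hz₀
  have hz₀m : (z₀ : ℂ) * (‖m‖ : ℂ) = m := by
    rw [hz₀, Circle.coe_exp, mul_comm]
    exact norm_mul_exp_arg_mul_I m
  have hproj : ‖m‖ = (conj (z₀ : ℂ) * m).re := by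
    conv_rhs => rw [← hz₀m]
    rw [← mul_assoc, ← Complex.normSq_eq_conj_mul_self, Circle.normSq_coe, Complex.ofReal_one, one_mul,
      Complex.ofReal_re]
  -- the projection is a tilted expectation
  have hintC : Integrable (fun z : Circle => (z : ℂ) * (tiltWeight w z : ℂ)) σ :=
    integrable_of_continuous_complex' σ
      (continuous_subtype_val.mul (Complex.continuous_ofReal.comp (continuous_tiltWeight w)))
  have hexp : (conj (z₀ : ℂ) * m).re = tiltExpect σ w (fun z => (conj (z₀ : ℂ) * z).re) := by
    rw [hm, tiltMean, tiltExpect, ← mul_div_assoc, Complex.div_ofReal_re, ← integral_const_mul,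
      ← RCLike.re_to_complex, ← integral_re (hintC.const_mul _)]
    congr 1
    refine integral_congr_ae (ae_of_all _ fun z => ?_)
    simp only [RCLike.re_to_complex, ← mul_assoc, Complex.re_mul_ofReal]
  rw [hproj, hexp]
  exact tiltExpect_re_conj_mul_le σ w z₀

/-! ### 8. The printed measure `μ`: Mathlib's exponentially tilted measure

The probability measure of Lemma 4.1 («density proportional to `exp Re(w z)` with respect to the
Haar measure») is, verbatim, Mathlib's exponential tilt `σ.tilted (fun z => Re(w z))`
(`Measure.tilted μ f = μ.withDensity (exp f / ∫ exp f dμ)`). This section identifies the expectation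
functional `tiltExpect` and the mean `tiltMean` with integrals against that measure and restates
Lemma 4.1 (pointwise form) and Corollary 4.2 for it. -/

/-- **The law of Lemma 4.1 as a measure**: `μ_w = σ.tilted (z ↦ Re(w z))`, density
`Z⁻¹ exp Re(w z)` with respect to the Haar probability measure `σ`.
[cite: Chatterjee2026CentralU1, §4 Lemma 4.1 (the measure `μ`)] -/
def tiltMeasure (w : ℂ) : Measure Circle :=
  σ.tilted fun z => (w * z).re

omit [BorelSpace Circle] in
/-- Unfolding lemma. [cite: Chatterjee2026CentralU1, §4 Lemma 4.1 (the measure `μ`)] -/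
theorem tiltMeasure_def (w : ℂ) : tiltMeasure σ w = σ.tilted fun z => (w * z).re := rfl

/-- `μ_w` is a probability measure (for a probability measure `σ`).
[cite: Chatterjee2026CentralU1, §4 Lemma 4.1 (the probability measure `μ`)] -/
theorem isProbabilityMeasure_tiltMeasure [IsProbabilityMeasure σ] (w : ℂ) :
    IsProbabilityMeasure (tiltMeasure σ w) :=
  isProbabilityMeasure_tilted (integrable_tiltWeight σ w)

omit [BorelSpace Circle] in
/-- **The tilted expectation functional is the integral against `μ_w`**:
`tiltExpect σ w f = ∫ f dμ_w` for every real observable `f`.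
[cite: Chatterjee2026CentralU1, §4 Lemma 4.1 (the measure `μ`)] -/
theorem integral_tiltMeasure_eq_tiltExpect (w : ℂ) (f : Circle → ℝ) :
    ∫ z, f z ∂(tiltMeasure σ w) = tiltExpect σ w f := by
  rw [tiltMeasure, integral_tilted, tiltExpect, tiltPartition]
  simp only [smul_eq_mul, tiltWeight]
  rw [← integral_div]
  refine integral_congr_ae (ae_of_all _ fun z => ?_)
  ring

omit [BorelSpace Circle] in
/-- **The mean of `μ_w` is `tiltMean`**: `∫ z dμ_w(z) = E(ξ)`.
[cite: Chatterjee2026CentralU1, §4 Corollary 4.2 (the mean `E(ξ)`)] -/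
theorem integral_coe_tiltMeasure_eq_tiltMean (w : ℂ) :
    ∫ z, (z : ℂ) ∂(tiltMeasure σ w) = tiltMean σ w := by
  rw [tiltMeasure, integral_tilted, tiltMean, tiltPartition]
  simp only [tiltWeight, Complex.real_smul, Complex.ofReal_div]
  rw [← integral_div]
  refine integral_congr_ae (ae_of_all _ fun z => ?_)
  ring

/-- **Lemma 4.1 (pointwise form) for the measure `μ_w`**: `∫ |z₀ − z|² dμ_w(z) ≥ (3/128)·min{1,|w|⁻¹}`
for every `z₀ ∈ U(1)`. [cite: Chatterjee2026CentralU1, §4 Lemma 4.1 (proof, last display)] -/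
theorem integral_normSq_sub_tiltMeasure_ge [IsProbabilityMeasure σ] [σ.IsMulLeftInvariant] (w : ℂ)
    (z₀ : Circle) :
    3 / 128 * anticoncRate w ≤ ∫ z, ‖(z₀ : ℂ) - z‖ ^ 2 ∂(tiltMeasure σ w) := by
  rw [integral_tiltMeasure_eq_tiltExpect]
  exact tiltExpect_normSq_sub_ge σ w z₀

/-- **Corollary 4.2 for the measure `μ_w`**: `|∫ z dμ_w(z)| ≤ 1 − (3/256)·min{1,|w|⁻¹}` — the mean of a
`U(1)`-valued random variable with law `μ_w` is bounded away from the unit circle, for every complex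
tilt `w` and every left-invariant probability measure `σ` on `U(1)`.
[cite: Chatterjee2026CentralU1, §4 Corollary 4.2] -/
theorem norm_integral_coe_tiltMeasure_le [IsProbabilityMeasure σ] [σ.IsMulLeftInvariant] (w : ℂ) :
    ‖∫ z, (z : ℂ) ∂(tiltMeasure σ w)‖ ≤ 1 - 3 / 256 * anticoncRate w := by
  rw [integral_coe_tiltMeasure_eq_tiltMean]
  exact norm_tiltMean_le σ w

end TiltedCircle

end Literature.Probability.LatticeModels

end
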